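import Summits.BirchSwinnertonDyer.BirchSwinnertonDyer.Theorems.AdditiveKolyvaginRoadManinFrameResidueProperRAuxPrimeBorel
import Literature.NumberTheory.GaloisRepresentations.SerreSL2Lifting
import HarnessLib

/-!
# The auxiliary prime of ROAD A′ (Ihara-free L-TWIST), II: regimes, absorption, the group-theoretic theorem — PROVED

Cell `pub/bsd-wall`, seat `bsd-wall-manin-p1` (prover, explicit-unit on AKR crux #7
stmt-BirchSwinnertonDyer-20709 `ManinFrameResidueProperR`, line `tame_twist`; serves equally the sibling line
`route-BirchSwinnertonDyer-EdixhovenFibreFiveSeven`, cruxes TDS57 22227 / KP57 23810 / CORNER 23883 / LOW 23884).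
THEOREMS ONLY (no definition, no named fact, no `sorry`); route-free. BSD is not proved by this file.

Sequel of `…AuxPrimeBorel.lean` (§§1–4 there: under the "badness" hypothesis every `γ` with `ω(γ) = −1`,
`det ρ(γ) ∉ {±1}` is triangular in the frame of complex conjugation, and all of them in the SAME Borel). Here:
§5 the two regimes of `(ω, det ∘ ρ)` — jointly onto `{±1} × 𝔽_pˣ` (forces `p ≡ 3 (mod 4)`, `p ≥ 7`) or
`ω = χ ∘ det` with `−1` a square; §6 absorption — a Borel containing those bad elements contains `ρ(Γ)`;
§7 the theorem:

**Theorem** (`exists_nonsquare_det_trace_ne`). Let `p ≥ 5`, `Γ` a group, `ρ : Γ →* M₂(𝔽_p)` multiplicative,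
`s : Γ →* 𝔽_pˣ` with values `±1`, `c ∈ Γ` with `ρ(c) = diag(1, −1)` and `s(c) = −1`, such that (i) no line of
`𝔽_p²` is stable under all `ρ(γ)`; (ii) `det ∘ ρ` is onto `𝔽_pˣ`; (iii) some `γ₀` has `s(γ₀)·det ρ(γ₀)` a
non-square. Then some `γ` has `s(γ)·det ρ(γ)` a non-square, `det ρ(γ) ≠ 1` and `tr ρ(γ) ≠ ±(1 + det ρ(γ))`.
(Arithmetic meaning, sibling `…AuxPrime.lean`: `Γ = Γ_ℚ`, `ρ = ρ̄_{E,p}` in the frame of the eigenvectors of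
complex conjugation, `s = χ₋₄`; the element is realised by Chebotarev as a prime `q ∤ 2pN` with `q*` a
non-square mod `p`, `q ≢ 1`, `a_q ≢ ±(q+1) (mod p)` — the auxiliary prime of the Ihara-free L-TWIST.)

Axioms: `propext`, `Classical.choice`, `Quot.sound`.

References: [DarmonDiamondTaylor1995] Lemma 4.12, §4.5 (auxiliary primes of level raising; context only).
-/

set_option autoImplicit false
-- the Theorems directory repeats the summit name (sibling precedent `SignedBaseChangeAssembly.lean`)
set_option linter.dupNamespace false

namespace Summit.BirchSwinnertonDyer.BirchSwinnertonDyer.Theorems.AuxPrime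

variable {p : ℕ} [Fact p.Prime] {Γ : Type*} [Group Γ]

/-! ### §5 The two regimes of `(ω, det)` -/

/-- **Regimes.** With `ω(γ) = χ(s(γ) det ρ(γ))` (`χ` the quadratic character of `𝔽_p`, `s = ±1`),
`det ρ(c) = −1`, `s(c) = −1`, `det ∘ ρ` onto `𝔽_pˣ` and `ω ≢ 1`: EITHER `p ≥ 7` and `(ω, det ∘ ρ)` is jointly
onto `{±1} × 𝔽_pˣ` (this happens iff `−1` is a non-square), OR every `γ` with `ω(γ) = −1` has
`det ρ(γ) ∉ {1, −1}` (`−1` a square, `ω = χ ∘ det`). [folklore] -/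
theorem regime (hp5 : 5 ≤ p) (ρ : Γ →* Matrix (Fin 2) (Fin 2) (ZMod p)) (s : Γ →* (ZMod p)ˣ)
    (hs : ∀ γ, s γ = 1 ∨ s γ = -1) (ω : Γ →* ℤˣ)
    (hωdef : ∀ γ, (ω γ : ℤ) = quadraticChar (ZMod p) ((s γ : ZMod p) * (ρ γ).det))
    {c : Γ} (hdc : (ρ c).det = -1) (hsc : s c = -1)
    (hdet : ∀ u : ZMod p, u ≠ 0 → ∃ γ, (ρ γ).det = u) (hω : ∃ γ₀, ω γ₀ = -1) :
    (7 ≤ p ∧ ∀ (e : ℤˣ) (u : ZMod p), u ≠ 0 → ∃ γ, ω γ = e ∧ (ρ γ).det = u) ∨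
    (∀ γ, ω γ = -1 → (ρ γ).det ≠ 1 ∧ (ρ γ).det ≠ -1) := by
  have hωneg : ∀ γ, ω γ = -1 ↔ quadraticChar (ZMod p) ((s γ : ZMod p) * (ρ γ).det) = -1 := by
    intro γ
    rw [← hωdef, Units.ext_iff, Units.val_neg, Units.val_one]
  have hωc : ω c = 1 := by
    rcases Int.units_eq_one_or (ω c) with h | h
    · exact h
    · exfalso
      rw [hωneg, hsc, hdc, Units.val_neg, Units.val_one, neg_mul_neg, one_mul, map_one] at h
      exact absurd h (by decide)
  by_cases hsq : IsSquare (-1 : ZMod p)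
  · right
    intro γ hγ
    rw [hωneg, map_mul] at hγ
    have hs1 : quadraticChar (ZMod p) (s γ : ZMod p) = 1 := by
      rcases hs γ with h | h
      · rw [h, Units.val_one, map_one]
      · rw [h, Units.val_neg, Units.val_one]
        exact (quadraticChar_one_iff_isSquare (neg_ne_zero.mpr one_ne_zero)).mpr hsq
    rw [hs1, one_mul, quadraticChar_neg_one_iff_not_isSquare] at hγ
    constructor
    · intro h
      exact hγ (by rw [h]; exact ⟨1, (mul_one 1).symm⟩)
    · intro h
      exact hγ (by rw [h]; exact hsq)
  · left
    refine ⟨seven_le_of_not_isSquare_neg_one hp5 hsq, ?_⟩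
    -- first: some `γ₁` with `ω = -1`, `det = 1`
    have hχneg : quadraticChar (ZMod p) (-1) = -1 :=
      (quadraticChar_neg_one_iff_not_isSquare).mpr hsq
    have hex : ∃ γ₁, ω γ₁ = -1 ∧ (ρ γ₁).det = 1 := by
      by_contra hno
      push Not at hno
      -- `ω` factors through `det`
      have hfac : ∀ γ γ' : Γ, (ρ γ).det = (ρ γ').det → ω γ = ω γ' := by
        intro γ γ' hd
        by_contra hne
        have hdet1 : (ρ (γ * γ'⁻¹)).det = 1 := by
          rw [map_mul, Matrix.det_mul, hd, det_mul_det_inv]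
        have hω1 : ω (γ * γ'⁻¹) = -1 := by
          rw [map_mul, map_inv]
          rcases Int.units_eq_one_or (ω γ) with h | h <;>
            rcases Int.units_eq_one_or (ω γ') with h' | h'
          · exact absurd (h.trans h'.symm) hne
          · rw [h, h']; decide
          · rw [h, h']; decide
          · exact absurd (h.trans h'.symm) hne
        exact hno _ hω1 hdet1
      obtain ⟨γ₀, hγ₀⟩ := hω
      set u₀ := (ρ γ₀).det with hu₀
      have hu₀0 : u₀ ≠ 0 := det_ne_zero ρ γ₀
      -- `u₀` is a non-square
      have hu₀nsq : ¬ IsSquare u₀ := by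
        rintro ⟨v, hv⟩
        have hv0 : v ≠ 0 := by
          rintro rfl
          rw [mul_zero] at hv
          exact hu₀0 hv
        obtain ⟨γv, hγv⟩ := hdet v hv0
        have hd : (ρ (γv * γv)).det = (ρ γ₀).det := by
          rw [map_mul, Matrix.det_mul, hγv, ← hv, hu₀]
        have h := hfac _ _ hd
        rw [map_mul, Int.units_mul_self, hγ₀] at h
        exact absurd h (by decide)
      -- `-u₀⁻¹` is a square: `u₀ w² = -1`
      have hsq' : IsSquare (-u₀⁻¹) := by
        have h1 : quadraticChar (ZMod p) (-u₀⁻¹) * quadraticChar (ZMod p) u₀ = -1 := by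
          rw [← map_mul, neg_mul, inv_mul_cancel₀ hu₀0, hχneg]
        rw [(quadraticChar_neg_one_iff_not_isSquare).mpr hu₀nsq, mul_neg, mul_one,
          neg_inj] at h1
        exact (quadraticChar_one_iff_isSquare
          (neg_ne_zero.mpr (inv_ne_zero hu₀0))).mp h1
      obtain ⟨w, hw⟩ := hsq'
      have hw0 : w ≠ 0 := by
        rintro rfl
        rw [mul_zero, neg_eq_zero, inv_eq_zero] at hw
        exact hu₀0 hw
      obtain ⟨γw, hγw⟩ := hdet w hw0
      have hd : (ρ (γ₀ * γw * γw)).det = (ρ c).det := by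
        rw [map_mul, map_mul, Matrix.det_mul, Matrix.det_mul, hγw, ← hu₀, hdc, mul_assoc, ← hw,
          mul_neg, mul_inv_cancel₀ hu₀0]
      have h := hfac _ _ hd
      rw [map_mul, map_mul, mul_assoc, Int.units_mul_self, mul_one, hγ₀, hωc] at h
      exact absurd h (by decide)
    obtain ⟨γ₁, hγ₁, hγ₁d⟩ := hex
    intro e u hu
    obtain ⟨γu, hγu⟩ := hdet u hu
    rcases Int.units_eq_one_or e with he | he <;>
      rcases Int.units_eq_one_or (ω γu) with h | h
    · exact ⟨γu, h.trans he.symm, hγu⟩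
    · refine ⟨γ₁ * γu, ?_, ?_⟩
      · rw [map_mul, hγ₁, h, he]; decide
      · rw [map_mul, Matrix.det_mul, hγ₁d, one_mul, hγu]
    · refine ⟨γ₁ * γu, ?_, ?_⟩
      · rw [map_mul, hγ₁, h, he, mul_one]
      · rw [map_mul, Matrix.det_mul, hγ₁d, one_mul, hγu]
    · exact ⟨γu, h.trans he.symm, hγu⟩

/-! ### §6 Absorption: a Borel containing the bad elements contains everything -/

/-- **Absorption, regime `ω = χ ∘ det`.** If `P` is closed under products and inverses and holds at every
`γ` with `ω(γ) = −1`, and some `x₀` has `ω(x₀) = −1`, then `P` holds everywhere. [folklore] -/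
theorem absorb_of_all_bad {P : Γ → Prop} (hPmul : ∀ x y, P x → P y → P (x * y))
    (hPinv : ∀ x, P x → P x⁻¹) (ω : Γ →* ℤˣ) (hΩ : ∀ γ, ω γ = -1 → P γ) {x₀ : Γ}
    (hx₀ : ω x₀ = -1) (γ : Γ) : P γ := by
  rcases Int.units_eq_one_or (ω γ) with h | h
  · have h1 : ω (x₀ * γ) = -1 := by rw [map_mul, h, mul_one, hx₀]
    have h2 := hPmul _ _ (hPinv _ (hΩ x₀ hx₀)) (hΩ _ h1)
    rwa [inv_mul_cancel_left] at h2
  · exact hΩ γ h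

/-- **Absorption, jointly surjective regime** (`p ≥ 7`). If `P` is closed under products and inverses and
holds at every `γ` with `ω(γ) = −1`, `det ρ(γ) ∉ {1, −1}`, and `(ω, det ∘ ρ)` is jointly onto, then `P` holds
everywhere: with `x₀` (`ω = −1`, `det = 2`), `P` holds on `ker ω` off `2·det = ±1`, hence on `ker ω` (choose
`h ∈ ker ω` with `det h` avoiding five values), hence on `x₀ · ker ω`. [folklore] -/
theorem absorb_of_surjective (hp7 : 7 ≤ p) (ρ : Γ →* Matrix (Fin 2) (Fin 2) (ZMod p)) (ω : Γ →* ℤˣ)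
    {P : Γ → Prop} (hPmul : ∀ x y, P x → P y → P (x * y)) (hPinv : ∀ x, P x → P x⁻¹)
    (hsurj : ∀ (e : ℤˣ) (u : ZMod p), u ≠ 0 → ∃ γ, ω γ = e ∧ (ρ γ).det = u)
    (hΩ : ∀ γ, ω γ = -1 → (ρ γ).det ≠ 1 → (ρ γ).det ≠ -1 → P γ) (γ : Γ) : P γ := by
  have hp5 : 5 ≤ p := by omega
  obtain ⟨h21, h21'⟩ := two_ne_one_and_neg_one hp5
  obtain ⟨x₀, hx₀, hdx₀⟩ := hsurj (-1) 2 (Literature.NumberTheory.GaloisRepresentations.Serre1968.two_ne_zero_of_five_le hp5)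
  have hPx₀ : P x₀ := hΩ x₀ hx₀ (by rw [hdx₀]; exact h21) (by rw [hdx₀]; exact h21')
  have hker : ∀ γ, ω γ = 1 → 2 * (ρ γ).det ≠ 1 → 2 * (ρ γ).det ≠ -1 → P γ := by
    intro γ h hn1 hn2
    have hω' : ω (x₀ * γ) = -1 := by rw [map_mul, hx₀, h, mul_one]
    have hd' : (ρ (x₀ * γ)).det = 2 * (ρ γ).det := by rw [map_mul, Matrix.det_mul, hdx₀]
    have h1 := hΩ _ hω' (by rw [hd']; exact hn1) (by rw [hd']; exact hn2)
    have h2 := hPmul _ _ (hPinv _ hPx₀) h1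
    rwa [inv_mul_cancel_left] at h2
  have hker' : ∀ γ, ω γ = 1 → P γ := by
    intro γ h
    obtain ⟨v, hv0, hv1, hv2, hv3, hv4⟩ := exists_avoid hp7 (ρ γ).det
    obtain ⟨h', hh', hdh'⟩ := hsurj 1 v hv0
    have hPh : P h' := hker h' hh' (by rw [hdh']; exact hv1) (by rw [hdh']; exact hv2)
    have hPhγ : P (h' * γ) := hker (h' * γ) (by rw [map_mul, hh', h, one_mul])
      (by rw [map_mul, Matrix.det_mul, hdh', ← mul_assoc]; exact hv3)
      (by rw [map_mul, Matrix.det_mul, hdh', ← mul_assoc]; exact hv4)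
    have h2 := hPmul _ _ (hPinv _ hPh) hPhγ
    rwa [inv_mul_cancel_left] at h2
  rcases Int.units_eq_one_or (ω γ) with h | h
  · exact hker' γ h
  · have h1 : ω (x₀⁻¹ * γ) = 1 := by
      rw [map_mul, map_inv, hx₀, h]
      decide
    have h2 := hPmul _ _ hPx₀ (hker' _ h1)
    rwa [mul_inv_cancel_left] at h2

/-! ### §7 The theorem -/

/-- **Auxiliary class for ROAD A′ — group theory.** Let `p ≥ 5`, `ρ : Γ →* M₂(𝔽_p)` multiplicative,
`s : Γ →* 𝔽_pˣ` with values `±1`, `c ∈ Γ` with `ρ(c) = diag(1, −1)`, `s(c) = −1`, such that no line of `𝔽_p²`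
is stable under every `ρ(γ)`, `det ∘ ρ` is onto `𝔽_pˣ`, and `s(γ₀) det ρ(γ₀)` is a non-square for some `γ₀`.
Then some `γ` has `s(γ) det ρ(γ)` a non-square, `det ρ(γ) ≠ 1`, `tr ρ(γ) ≠ 1 + det ρ(γ)` and
`tr ρ(γ) ≠ −(1 + det ρ(γ))`. (Arithmetic meaning, sibling file: a Frobenius `q` with `q*` a non-square mod
`p`, `q ≢ 1`, `a_q ≢ ±(q + 1) (mod p)`.) See the module docstring for the proof. [folklore] -/
theorem exists_nonsquare_det_trace_ne (hp5 : 5 ≤ p) (ρ : Γ →* Matrix (Fin 2) (Fin 2) (ZMod p))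
    (s : Γ →* (ZMod p)ˣ) (hs : ∀ γ, s γ = 1 ∨ s γ = -1) {c : Γ} (hc : ρ c = !![1, 0; 0, -1])
    (hsc : s c = -1)
    (hirr : ∀ v : Fin 2 → ZMod p, v ≠ 0 → ∃ γ, ∀ a : ZMod p, (ρ γ).mulVec v ≠ a • v)
    (hdet : ∀ u : ZMod p, u ≠ 0 → ∃ γ, (ρ γ).det = u)
    (hω : ∃ γ₀, ¬ IsSquare ((s γ₀ : ZMod p) * (ρ γ₀).det)) :
    ∃ γ, ¬ IsSquare ((s γ : ZMod p) * (ρ γ).det) ∧ (ρ γ).det ≠ 1 ∧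
      (ρ γ).trace ≠ 1 + (ρ γ).det ∧ (ρ γ).trace ≠ -(1 + (ρ γ).det) := by
  classical
  -- the character `ω = χ(s · det ρ)` as a hom `Γ →* ℤˣ`
  set dU : Γ →* (ZMod p)ˣ := Matrix.GeneralLinearGroup.det.comp ρ.toHomUnits with hdU
  have hdUval : ∀ γ, (dU γ : ZMod p) = (ρ γ).det := fun γ ↦ rfl
  set ω : Γ →* ℤˣ := (quadraticChar (ZMod p)).toUnitHom.comp (s * dU) with hωdef'
  have hωdef : ∀ γ, (ω γ : ℤ) = quadraticChar (ZMod p) ((s γ : ZMod p) * (ρ γ).det) := by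
    intro γ
    rw [hωdef', MonoidHom.comp_apply, MulChar.coe_toUnitHom, MonoidHom.mul_apply, Units.val_mul,
      hdUval]
  have hωneg : ∀ γ, ω γ = -1 ↔ ¬ IsSquare ((s γ : ZMod p) * (ρ γ).det) := by
    intro γ
    rw [← quadraticChar_neg_one_iff_not_isSquare, ← hωdef, Units.ext_iff, Units.val_neg,
      Units.val_one]
  have hdetc : (ρ c).det = -1 := by
    rw [hc, Matrix.det_fin_two]
    simp
  have hωc : ω c = 1 := by
    rcases Int.units_eq_one_or (ω c) with h | h
    · exact h
    · exfalso
      rw [hωneg, hsc, hdetc, Units.val_neg, Units.val_one, neg_mul_neg, one_mul] at h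
      exact h ⟨1, (mul_one 1).symm⟩
  obtain ⟨γ₀, hγ₀⟩ := hω
  have hω' : ∃ γ₀, ω γ₀ = -1 := ⟨γ₀, (hωneg γ₀).mpr hγ₀⟩
  by_contra hgood
  push Not at hgood
  have hB : ∀ γ, ω γ = -1 → (ρ γ).det ≠ 1 →
      (ρ γ).trace = 1 + (ρ γ).det ∨ (ρ γ).trace = -(1 + (ρ γ).det) := by
    intro γ hγ h1
    by_cases h : (ρ γ).trace = 1 + (ρ γ).det
    · exact Or.inl h
    · exact Or.inr (hgood γ ((hωneg γ).mp hγ) h1 h)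
  -- the common eigenvector contradiction, for each Borel
  have hupper : ¬ ∀ γ, ρ γ 1 0 = 0 := by
    intro hall
    obtain ⟨γ, hγ⟩ := hirr (Pi.single 0 1) (fun h ↦ by simpa using congrFun h 0)
    apply hγ (ρ γ 0 0)
    rw [Matrix.mulVec_single_one]
    funext i
    fin_cases i
    · simp [Matrix.col_apply]
    · simp [Matrix.col_apply, hall γ]
  have hlower : ¬ ∀ γ, ρ γ 0 1 = 0 := by
    intro hall
    obtain ⟨γ, hγ⟩ := hirr (Pi.single 1 1) (fun h ↦ by simpa using congrFun h 1)
    apply hγ (ρ γ 1 1)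
    rw [Matrix.mulVec_single_one]
    funext i
    fin_cases i
    · simp [Matrix.col_apply, hall γ]
    · simp [Matrix.col_apply]
  rcases regime hp5 ρ s hs ω hωdef hdetc hsc hdet hω' with ⟨hp7, hsurj⟩ | hII
  · rcases upper_or_lower hp5 ρ ω hc hωc hB with hU | hL
    · exact hupper (absorb_of_surjective hp7 ρ ω (P := fun γ ↦ ρ γ 1 0 = 0)
        (fun x y hx hy ↦ upper_mul ρ hx hy) (fun x hx ↦ upper_inv ρ hx) hsurj hU)
    · exact hlower (absorb_of_surjective hp7 ρ ω (P := fun γ ↦ ρ γ 0 1 = 0)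
        (fun x y hx hy ↦ lower_mul ρ hx hy) (fun x hx ↦ lower_inv ρ hx) hsurj hL)
  · obtain ⟨x₀, hx₀⟩ := hω'
    rcases upper_or_lower hp5 ρ ω hc hωc hB with hU | hL
    · exact hupper (absorb_of_all_bad (P := fun γ ↦ ρ γ 1 0 = 0)
        (fun x y hx hy ↦ upper_mul ρ hx hy) (fun x hx ↦ upper_inv ρ hx) ω
        (fun γ hγ ↦ hU γ hγ (hII γ hγ).1 (hII γ hγ).2) hx₀)
    · exact hlower (absorb_of_all_bad (P := fun γ ↦ ρ γ 0 1 = 0)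
        (fun x y hx hy ↦ lower_mul ρ hx hy) (fun x hx ↦ lower_inv ρ hx) ω
        (fun γ hγ ↦ hL γ hγ (hII γ hγ).1 (hII γ hγ).2) hx₀)

end Summit.BirchSwinnertonDyer.BirchSwinnertonDyer.Theorems.AuxPrime
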